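import Summits.FinalStateConjecture.FinalStateConjecture.Theses.EIHFluxBalance

/-!
# Route EIHFluxBalance — Assembly

The assembly item of route `EIHFluxBalance` for the Final State Conjecture:
`ModulatedKerrHandoff → InertialRecession → FinalStateConjecture` (rev 3; since rev 6 it reads
`InertialRecession → ModulatedKerrHandoff → FinalStateConjecture`, see the second repair note).

This is (up to the order of the two hypotheses) the type of the route file's deciding theorem
`Summit.FinalStateConjecture.FinalStateConjecture.Theses.EIHFluxBalance.closes`
(monotonicity of Christodoulou genericity in the property: the engine
`InertialRecession` upgrades, pointwise in the admissible datum and the MGHD,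
the modulated-ansatz conclusion of `ModulatedKerrHandoff` to the Statement's
final-state decomposition clause, so the exceptional set only shrinks and the
one-parameter families supplied by `ModulatedKerrHandoff` work verbatim).

**Repair 2026-08-16.** `Assembly_proof` proved the rev-3 CURRIED assembly
`ModulatedKerrHandoff → InertialRecession → FinalStateConjecture` (item
stmt-FinalStateConjecture-10169, closed `proved` by it at 32daf3564dd5). The rev-4 repair of the
route restated the item UNDER THE SAME DECL NAME `Assembly` in uncurried frame form
`ModulatedKerrHandoff ∧ InertialRecession → FinalStateConjecture` (item
stmt-FinalStateConjecture-14037, proved by the cycle-free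
`Theorems.EIHFluxBalance.assembly_frame_proof` of `EIHFluxBalanceAssemblyFrame.lean`, which does
not import the route module), so the old proof term (`exact closes`, curried) stopped elaborating
against the new definiens (fullbuild breakage "29:2: Type mismatch"). The theorem keeps its name
and statement text (Theorems files are append-only) and now proves the current `Assembly` by the
same deciding theorem, uncurried (`fun h ↦ closes h.1 h.2`). It is a second, dependent proof of
stmt-FinalStateConjecture-14037 and must NOT be used as that item's `Assembly_holds` link: this
module imports the route module (see the warning in the route file's `Assembly` docstring);
`assembly_frame_proof` remains the closing theorem.

**Repair 2026-08-16 (bis), rev 6/7.** The route repair of 2026-08-16T23:18Z (summit re-type p126844,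
TAME genericity) restated the item again under the same decl name, now CURRIED WITH E FIRST:
`Assembly := InertialRecession → ModulatedKerrHandoff → FinalStateConjecture` (item
stmt-FinalStateConjecture-17404, closed by the cycle-free
`Theorems.EIHFluxBalance.assembly_tame_frame_proof` of `EIHFluxBalanceAssemblyTameFrame.lean`).
The uncurried proof term `fun h ↦ closes h.1 h.2` stopped elaborating ("49:95: Invalid
projection … h has function type"); the theorem keeps its name and statement text and now proves
the current `Assembly` by the deciding theorem with its hypotheses swapped
(`fun hE hH ↦ closes hH hE`). Still NOT usable as an `Assembly_holds` link (this module imports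
the route module).
-/

namespace Summit.FinalStateConjecture.FinalStateConjecture.Theorems

set_option linter.dupNamespace false

/-- **Assembly of route EIHFluxBalance.**
`ModulatedKerrHandoff → InertialRecession → FinalStateConjecture`: the large-data
handoff to a modulated multi-Kerr–Schild ansatz together with inertial recession
(freezing of the moduli) imply the Final State Conjecture as stated in
`Summits/FinalStateConjecture/Statement.lean`. Proof: unfold `Assembly` and apply the
route's sorry-free deciding theorem `Theses.EIHFluxBalance.closes` (since the rev-6 restate
under the same decl name, `Assembly` is the curried frame
`InertialRecession → ModulatedKerrHandoff → FinalStateConjecture`, item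
stmt-FinalStateConjecture-17404, so `closes` is applied with its two hypotheses swapped — see
the module docstring). -/
theorem Assembly_proof :
    Summit.FinalStateConjecture.FinalStateConjecture.Theses.EIHFluxBalance.Assembly := by
  unfold Summit.FinalStateConjecture.FinalStateConjecture.Theses.EIHFluxBalance.Assembly
  -- rev ≥ 6: `Assembly` is the curried frame `E → H → FinalStateConjecture`
  exact fun hE hH =>
    Summit.FinalStateConjecture.FinalStateConjecture.Theses.EIHFluxBalance.closes hH hE

end Summit.FinalStateConjecture.FinalStateConjecture.Theorems
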